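import Summits.QuantumFields.BalabanUV.T4Continuum.Support.NE7AccumulatedFrameLinearisation
import Summits.QuantumFields.BalabanUV.T4Continuum.Support.NE3CurvedFrameKill
import Literature.MathematicalPhysics.QuantumFieldTheory.Balaban1983to89.B7Prop6GeneralAnalytic
import Literature.MathematicalPhysics.QuantumFieldTheory.Balaban1983to89.B7Eq162General
import Mathlib.Analysis.Complex.Schwarz
import HarnessLib

/-!
# NE7FrameDefectLipschitz — (R1′) letter (LP) of memo ROAD-G103 §3: THE NONLINEAR-MINUS-LINEAR ACCUMULATED FRAME `P(X) := mlog v_k(X) − framePotW L k W X` IS LIPSCHITZ WITH A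
# SECOND-ORDER CONSTANT — `‖P(X′)(z) − P(X)(z)‖ ≤ 8·C_Γ·(L^k)²·(‖X‖_∞ + ‖X′ − X‖_∞)·‖X′ − X‖_∞` (k-free `C_Γ = 56(dL)² + 16C₁dL`) — by ANALYTICITY + SCHWARZ, and the
# ℂ-HOMOGENEITY OF THE LINEARISED TOWER (`pushDir`, `frameLin`, `Qbar`, `QbarIter`, `framePotW` over complex scalars)

Cell `pub-balaban`, rung (B)+1 sub-cell t4, lineage `b2b-balaban-t4-ne7-p1` (CRUX PROVER NE7 #1 = OWNER of BINDER row NE7), generation 103.  Memo `t4/b2b-balaban-t4-ne7-p1-g103/ROAD-G103.md`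
§1–§3 (FINDING-1: the cross-level corner-charge polygon of the LINEARLY matched frames sits in the coarse datum `φ(u⋆)` as `−gaugeDir_V P(X⋆)`; the repair (R1′) re-runs the (S1) engine on the
NONLINEAR frame target, whose one new estimate is THIS file's (LP): the extra corner junk `P(X⁰) − P(X¹)` of a step is a multiple `O(M·sup‖X‖) = O(ε)` of the step).
THE PROOF.  §1 the linearised tower is ℂ-homogeneous in the direction (verbatim copies of the real-scalar lemmas `dhol_smul`, `mlogDeriv_smul`, `XavgDeriv_smul`, `sideDeriv_smul`, `pushDir_smul`,
`frameLin_smul`, `Qbar_smul`, `QbarIter_smul` of `AveragingDeficitTransportCalc` ∕ `AveragingDeficitPushForwardLinear` ∕ `NE3SmoothRightInverseW` with `Ad_smul` (complex) in place of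
`Ad_real_smul`; `framePotW` by the induction of `NE3CurvedFrameKill.framePotW_add`).  §2 on the complex line `t ↦ X + t•D` the map `t ↦ mlog v_k(X + t•D)(z)` is holomorphic on the sup-ball
(B7 Prop. 4∕6 analyticity `B7Prop6GeneralAnalytic.analyticAt_vcovQ` with `B(t) = adField W (X + t•D)`, `vcov = vcovQ` there by `B7Eq123General.dbavgCovIter_eq_expCfg_logCovIter` +
`vcov_eq_vcovQ`, `MatrixLog.analyticAt_mlog` on `‖v − 1‖ ≤ 64dL^kb < 1` by `B7Eq162General.eq163_general`), `framePotW (X + t•D) = framePotW X + t•framePotW D` (§1), and the sup letter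
`NE7AccumulatedFrameLinearisation.norm_mlog_vcov_sub_framePotW_le` (no skewness hypothesis: it bounds `P` on COMPLEX fields) bounds `P(X + t•D)` by `C_Γ(L^k b₁)²` on the ball `‖t‖ < R₁`,
`R₁ = ‖X‖_∞∕‖D‖_∞ + 2`, `b₁ = 2(‖X‖_∞ + ‖D‖_∞)`; Schwarz (`Complex.dist_le_div_mul_dist_of_mapsTo_ball`): `‖P(X + D) − P(X)‖ ≤ 2C_Γ(L^k b₁)²∕R₁ ≤ 8C_Γ(L^k)²(‖X‖_∞ + ‖D‖_∞)‖D‖_∞`. WHAT ([folklore]; 0 def, 0 sorry).  §1 `jexp_smulC`, `dhol_smulC`, `mlogDeriv_smulC`, `XavgDeriv_smulC`, `sideDeriv_smulC`, `pushDir_smulC`, `frameLin_smulC`, `Fbar_smulC`, `Qbar_smulC`,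
`QbarIter_smulC`, `framePotW_smulC`, `framePotW_line`.  §2 `norm_line_le`, `vcov_relPert_eq_vcovQ`, `norm_vcov_relPert_sub_one_le`, `analyticAt_mlog_vcov_line`, **`norm_frameDefect_sub_le`**
(= (LP), `X` and `X + D`), **`norm_frameDefect_sub_frameDefect_le`** (= (LP), `X` and `X′`).
HONEST FRAMING (page 1): lattice∕matrix calculus of OUR objects over landed kernel theorems and [Balaban1985Averaging] Prop. 4∕6's analyticity AS TYPED in the tree; nothing of Bałaban's asserted;
NOT the re-issued (S1) engine, NOT (S2), NOT NE7; spine 0∕9; finite T⁴ rung (B)+1 — NOT infinite volume, NOT mass gap, NOT BetaPertH, NOT Clay (continuum YM on T⁴ ⇐ BetaPertH ∧ nine spine estimates, 0/9).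
-/

set_option autoImplicit false

open scoped BigOperators Matrix Matrix.Norms.L2Operator Topology
open NormedSpace Finset Metric Set

namespace Summit.QuantumFields.BalabanUV.T4Continuum.NE7FrameDefectLipschitz

open Literature.MathematicalPhysics.QuantumFieldTheory.Balaban1983to89
open B7Prop1Explicit B7Prop2Explicit B7Prop3Flat MatrixLog
open B7Eq92Concrete (vcov dbavgCovIter)
open B7Prop4GeneralLevels (logCovIter)
open B7Eq123General (prop4_general dbavgCovIter_eq_expCfg_logCovIter)
open B7Prop6GeneralAnalytic (vcovQ vcov_eq_vcovQ analyticAt_vcovQ)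
open B7Eq162General (eq163_general)
open T4AveragingDeficitWall (Ad IsUnitaryCfg SmallField)
open AveragingDeficitTransport (dhol dstep dhol_cons norm_Ad_of_unitary)
open AveragingDeficitTransportCalc (jexp_add)
open AveragingDeficitNearIdentity (Ad_add Ad_smul Ad_real_smul)
open AveragingDeficitSideDeriv (jexp mlogDeriv XavgDeriv sideDeriv jexp_mlog_eq_Ad)
open AveragingDeficitTransportCalc (jexp_injective)
open AveragingDeficitPushForwardLinear (small_regime)
open AveragingDeficitResidualPairing (pushDir)
open AveragingDeficitChartCalculus (cavg)
open AveragingDeficitMultiLevelPrep (cavgIter LevelSmall)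
open BlockAveragePushDirSplit (frameLin dbarLin)
open NE3TangentCovariantStructure (Qbar Fbar norm_Wcx_sub_one_le_32)
open NE3TangentCovariantTower (QbarIter framePotW framePotW_succ framePotW_one step_small)
open NE3CurvedFrameKill (framePotW_add)
open NE3.QbarDictionary (adField relPert_eq_expCfg_adField)
open NE3.PairLandauB8Avg (relPert)

noncomputable section
variable {d : ℕ} {n : Type*} [Fintype n] [DecidableEq n]


/-! ## §1 The linearised tower is ℂ-homogeneous in the direction -/

/-- `J_X(c•Y) = c•J_X(Y)` for complex `c`. [folklore] -/
theorem jexp_smulC (X : (Matrix n n ℂ)) (c : ℂ) (Y : (Matrix n n ℂ)) : jexp X (c • Y) = c • jexp X Y := by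
  unfold jexp
  rw [← intervalIntegral.integral_smul]
  refine intervalIntegral.integral_congr fun r _ => ?_
  simp only [Matrix.mul_smul, Matrix.smul_mul]

/-- `δ` is complex-homogeneous in the direction. [folklore] -/
theorem dhol_smulC (V : Site d → Fin d → (Matrix n n ℂ)ˣ) (c : ℂ) (ψ : Site d → Fin d → (Matrix n n ℂ)) :
    ∀ (x : Site d) (w : List (Letter d)), dhol V (c • ψ) x w = c • dhol V ψ x w
  | x, [] => by simp
  | x, l :: w => by
    have hstep : dstep V (c • ψ) x l = c • dstep V ψ x l := by
      obtain ⟨μ, b⟩ := l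
      cases b
      · simp only [dstep, Bool.false_eq_true, ↓reduceIte, Pi.smul_apply, smul_neg]
      · simp only [dstep, ↓reduceIte, Pi.smul_apply, Ad_smul]
    rw [dhol_cons, dhol_cons, hstep, dhol_smulC V c ψ (x + l.vec) w, Ad_smul, smul_add]

/-- `(log W_s)′` is complex-homogeneous in the direction (loop identity + injectivity of `J_{log W}`). [folklore] -/
theorem mlogDeriv_smulC (L : ℕ) (V : Site d → Fin d → (Matrix n n ℂ)ˣ) (c : ℂ) (ψ : Site d → Fin d → (Matrix n n ℂ)) (q : Site d) (κ : Fin d)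
    (r : Fin d → Fin L) (hW : ‖((Wcx L V q κ (boxVec L r) : (Matrix n n ℂ)ˣ) : (Matrix n n ℂ)) - 1‖ ≤ 1 / 32) :
    mlogDeriv L V (c • ψ) q κ (boxVec L r) = c • mlogDeriv L V ψ q κ (boxVec L r) := by
  obtain ⟨hW1, hX⟩ := small_regime hW
  refine jexp_injective _ hX ?_
  rw [jexp_smulC, jexp_mlog_eq_Ad L V _ q κ r hW1, jexp_mlog_eq_Ad L V _ q κ r hW1, dhol_smulC, Ad_smul]

/-- `X_c′` is complex-homogeneous in the direction. [folklore] -/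
theorem XavgDeriv_smulC (L : ℕ) (V : Site d → Fin d → (Matrix n n ℂ)ˣ) (c : ℂ) (ψ : Site d → Fin d → (Matrix n n ℂ)) (q : Site d) (κ : Fin d)
    (hW : ∀ r : Fin d → Fin L, ‖((Wcx L V q κ (boxVec L r) : (Matrix n n ℂ)ˣ) : (Matrix n n ℂ)) - 1‖ ≤ 1 / 32) :
    XavgDeriv L V (c • ψ) q κ = c • XavgDeriv L V ψ q κ := by
  unfold XavgDeriv
  rw [Finset.smul_sum]
  exact Finset.sum_congr rfl fun r _ => by rw [mlogDeriv_smulC L V c ψ q κ r (hW r), smul_comm]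

/-- `δV̄(c)` is complex-homogeneous in the direction. [folklore] -/
theorem sideDeriv_smulC (L : ℕ) (V : Site d → Fin d → (Matrix n n ℂ)ˣ) (c : ℂ) (ψ : Site d → Fin d → (Matrix n n ℂ)) (q : Site d) (κ : Fin d)
    (hW : ∀ r : Fin d → Fin L, ‖((Wcx L V q κ (boxVec L r) : (Matrix n n ℂ)ˣ) : (Matrix n n ℂ)) - 1‖ ≤ 1 / 32) :
    sideDeriv L V (c • ψ) q κ = c • sideDeriv L V ψ q κ := by
  unfold sideDeriv
  rw [XavgDeriv_smulC L V c ψ q κ hW, jexp_smulC, dhol_smulC, ← smul_add, Ad_smul]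

/-- **THE DIFFERENTIAL OF (42) IS COMPLEX-HOMOGENEOUS IN THE DIRECTION** (regime `|V(Γ_{c,x})V(c)⁻¹ − 1| ≤ 1∕32`). [folklore] -/
theorem pushDir_smulC (L : ℕ) (V : Site d → Fin d → (Matrix n n ℂ)ˣ) (c : ℂ) (ψ : Site d → Fin d → (Matrix n n ℂ)) (q : Site d) (κ : Fin d)
    (hW : ∀ r : Fin d → Fin L, ‖((Wcx L V q κ (boxVec L r) : (Matrix n n ℂ)ˣ) : (Matrix n n ℂ)) - 1‖ ≤ 1 / 32) :
    pushDir L V (c • ψ) q κ = c • pushDir L V ψ q κ := by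
  unfold pushDir
  rw [sideDeriv_smulC L V c ψ q κ hW, Ad_smul]

/-- The linearised block frame is complex-homogeneous. [folklore] -/
theorem frameLin_smulC (L : ℕ) (W : Site d → Fin d → (Matrix n n ℂ)ˣ) (c : ℂ) (Y : Site d → Fin d → (Matrix n n ℂ)) (y : Site d) :
    frameLin L W (c • Y) y = c • frameLin L W Y y := by
  unfold frameLin
  rw [Finset.smul_sum]
  exact Finset.sum_congr rfl fun r _ => by rw [dhol_smulC, smul_comm]

/-- `Fbar` is complex-homogeneous. [folklore] -/
theorem Fbar_smulC (L : ℕ) (W : Site d → Fin d → (Matrix n n ℂ)ˣ) (c : ℂ) (Y : Site d → Fin d → (Matrix n n ℂ)) :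
    Fbar L W (c • Y) = fun z => c • Fbar L W Y z := by
  funext z
  exact frameLin_smulC L W c Y _

/-- **`Qbar` IS COMPLEX-HOMOGENEOUS** (in the loop ball of the small-field class). [folklore] -/
theorem Qbar_smulC [Nonempty n] {L : ℕ} (hL : 1 ≤ L) {W : Site d → Fin d → (Matrix n n ℂ)ˣ} (hWu : IsUnitaryCfg W) {a : ℝ} (ha : 0 ≤ a)
    (h512 : 512 * (d + 1) * (d + 4) * (L : ℝ) ^ 2 * a ≤ 1) (hWa : SmallField W a) (c : ℂ) (Y : Site d → Fin d → (Matrix n n ℂ)) :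
    Qbar L W (c • Y) = c • Qbar L W Y := by
  funext z κ
  have hW := fun r => norm_Wcx_sub_one_le_32 hL hWu ha h512 hWa ((L : ℤ) • z) κ r
  show dbarLin L W (c • Y) ((L : ℤ) • z) κ = c • dbarLin L W Y ((L : ℤ) • z) κ
  simp only [dbarLin, pushDir_smulC L W c Y _ κ hW, frameLin_smulC, Ad_smul, smul_sub]

/-- **THE k-FOLD DOUBLE-BAR AVERAGE IS COMPLEX-HOMOGENEOUS** (multi-level small-field class). [folklore] -/
theorem QbarIter_smulC [Nonempty n] {L : ℕ} (hL : 1 ≤ L) (j : ℕ) :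
    ∀ {W : Site d → Fin d → (Matrix n n ℂ)ˣ} {x : ℝ}, IsUnitaryCfg W → 0 ≤ x → LevelSmall d L j x → SmallField W x →
    ∀ (c : ℂ) (Y : Site d → Fin d → (Matrix n n ℂ)), QbarIter L (j + 1) W (c • Y) = c • QbarIter L (j + 1) W Y := by
  induction j with
  | zero =>
      intro W x hWu hx hs hWx c Y
      obtain ⟨h512, -, -, -⟩ := step_small hL hWu hx hs hWx
      exact Qbar_smulC hL hWu hx h512 hWx c Y
  | succ j ih =>
      intro W x hWu hx hs hWx c Y
      obtain ⟨h512, hW₁u, hr0, hW₁x⟩ := step_small hL hWu hx hs.1 hWx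
      show QbarIter L (j + 1) (cavg L W) (Qbar L W (c • Y)) = c • QbarIter L (j + 1) (cavg L W) (Qbar L W Y)
      rw [Qbar_smulC hL hWu hx h512 hWx, ih hW₁u hr0 hs.2 hW₁x]

/-- **THE ACCUMULATED FRAMES ARE COMPLEX-HOMOGENEOUS** in the multi-level small-field class: `framePotW L (j+1) W (c•Y) z = c • framePotW L (j+1) W Y z`. [folklore] -/
theorem framePotW_smulC [Nonempty n] {L : ℕ} (hL : 1 ≤ L) (j : ℕ) :
    ∀ {W : Site d → Fin d → (Matrix n n ℂ)ˣ} {x : ℝ}, IsUnitaryCfg W → 0 ≤ x → LevelSmall d L j x → SmallField W x →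
    ∀ (c : ℂ) (Y : Site d → Fin d → (Matrix n n ℂ)) (z : Site d), framePotW L (j + 1) W (c • Y) z = c • framePotW L (j + 1) W Y z := by
  induction j with
  | zero =>
      intro W x _ _ _ _ c Y z
      rw [zero_add, framePotW_one, framePotW_one, Fbar_smulC]
  | succ j ih =>
      intro W x hWu hx hs hWx c Y z
      obtain ⟨h512, hW₁u, hr0, hW₁x⟩ := step_small hL hWu hx hs.1 hWx
      have hrec : ∀ Y' : Site d → Fin d → (Matrix n n ℂ), framePotW L (j + 1 + 1) W Y' z
          = framePotW L (j + 1) (cavg L W) (Qbar L W Y') z + Fbar L W Y' (((L : ℤ) ^ (j + 1)) • z) := by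
        intro Y'; rw [framePotW_succ]
      rw [hrec, hrec, Qbar_smulC hL hWu hx h512 hWx, ih hW₁u hr0 hs.2 hW₁x, Fbar_smulC, smul_add]

/-- **THE ACCUMULATED FRAME ALONG A COMPLEX LINE**: `framePotW (X + t•D) z = framePotW X z + t • framePotW D z` (class). [folklore] -/
theorem framePotW_line [Nonempty n] {L : ℕ} (hL : 1 ≤ L) (j : ℕ) {W : Site d → Fin d → (Matrix n n ℂ)ˣ} {x : ℝ} (hWu : IsUnitaryCfg W) (hx : 0 ≤ x)
    (hs : LevelSmall d L j x) (hWx : SmallField W x) (X D : Site d → Fin d → (Matrix n n ℂ)) (t : ℂ) (z : Site d) :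
    framePotW L (j + 1) W (fun y κ => X y κ + t • D y κ) z = framePotW L (j + 1) W X z + t • framePotW L (j + 1) W D z := by
  have h := framePotW_add hL j hWu hx hs hWx X (t • D) z
  have e : (fun y ν => X y ν + (t • D) y ν) = fun y κ => X y κ + t • D y κ := by
    funext y ν; rfl
  rw [e] at h
  rw [h, framePotW_smulC hL j hWu hx hs hWx t D z]

/-! ## §2 The nonlinear-minus-linear accumulated frame along a complex line: analyticity, the sup ball, Schwarz -/

section Analytic

variable [Nonempty n] {L : ℕ} (hL : 2 ≤ L) (k : ℕ) {W : Site d → Fin d → (Matrix n n ℂ)ˣ} (hWu : IsUnitaryCfg W)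
  {α₀ : ℝ} (hα : 0 < α₀) (hα3 : C0 d * α₀ ≤ 1 / 3) (hα4 : 4 * α₀ ≤ c2' d L) (h52 : pdev W < α₀ * (((L : ℝ) ^ (k + 1))⁻¹) ^ 2)

omit [Nonempty n] in
/-- sup bound along the complex line: `‖X + t•D‖ ≤ b + ‖t‖δ`. [folklore] -/
theorem norm_line_le {X D : Site d → Fin d → (Matrix n n ℂ)} {b δ : ℝ} (hX : ∀ y κ, ‖X y κ‖ ≤ b) (hD : ∀ y κ, ‖D y κ‖ ≤ δ)
    (t : ℂ) (y : Site d) (κ : Fin d) : ‖X y κ + t • D y κ‖ ≤ b + ‖t‖ * δ := by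
  calc ‖X y κ + t • D y κ‖ ≤ ‖X y κ‖ + ‖t • D y κ‖ := norm_add_le _ _
    _ ≤ b + ‖t‖ * δ := by rw [norm_smul]; exact add_le_add (hX y κ) (mul_le_mul_of_nonneg_left (hD y κ) (norm_nonneg _))

include hL hWu hα hα3 hα4 h52 in
/-- **IN THE PROP-4 REGIME THE ACCUMULATED FRAME IS THE ANALYTIC COMPOSITE**: `vcov L W (relPert W Y) (k+1) = vcovQ L W (adField W Y) (k+1)` for `sup‖Y‖ ≤ b₁` (B7 (127)∕(160):
`U̿′ʲ = e^{Q_j}` by `dbavgCovIter_eq_expCfg_logCovIter`, then `vcov_eq_vcovQ`). [cite: Balaban1985Averaging, (160) p.42, (127) p.37] -/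
theorem vcov_relPert_eq_vcovQ {Y : Site d → Fin d → (Matrix n n ℂ)} {b₁ : ℝ} (hb₁ : 0 ≤ b₁) (hY : ∀ y κ, ‖Y y κ‖ ≤ b₁)
    (hsmall : Real.exp (4 * (800 * ((d : ℝ) + 1) ^ 2 * ((d : ℝ) + 4)) * α₀)
      * (1 + 8 * (131072 * ((d : ℝ) + 1) ^ 2) * ((L : ℝ) ^ (k + 1) * b₁)) ≤ 2)
    (hc₃ : 2 * ((L : ℝ) ^ (k + 1) * b₁) ≤ c3 d L) :
    ∀ j ≤ k + 1, vcov L W (relPert W Y) j = vcovQ L W (adField W Y) j := by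
  letI : CStarAlgebra (Matrix n n ℂ) := {}
  have hG := avgClosed_unitaryUnits d (𝔸 := Matrix n n ℂ) L
  have hU₀ : ∀ (y : Site d) (κ : Fin d), W y κ ∈ unitaryUnits (Matrix n n ℂ) := hWu
  have hBsup : ∀ (y : Site d) (κ : Fin d), ‖adField W Y y κ‖ ≤ b₁ := fun y κ => by
    unfold adField; rw [norm_Ad_of_unitary (hWu y κ)]; exact hY y κ
  have hQ := dbavgCovIter_eq_expCfg_logCovIter L hL hG (k + 1) W hU₀ hα hα3 hα4 h52 (adField W Y) hb₁ hBsup hsmall hc₃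
  rw [relPert_eq_expCfg_adField]
  exact vcov_eq_vcovQ L W (adField W Y) (k + 1) hQ

include hL hWu hα hα3 hα4 h52 in
/-- **THE ACCUMULATED FRAME IS NEAR `1`** in the regime: `‖v_{k+1}(Y)(z) − 1‖ ≤ 64·d·(L^{k+1}b₁) ≤ 1∕32` ([Balaban1985Averaging] (163), tree `B7Eq162General.eq163_general`).
[cite: Balaban1985Averaging, (163) p.42] -/
theorem norm_vcov_relPert_sub_one_le {Y : Site d → Fin d → (Matrix n n ℂ)} {b₁ : ℝ} (hb₁ : 0 ≤ b₁) (hY : ∀ y κ, ‖Y y κ‖ ≤ b₁)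
    (hsmall : Real.exp (4 * (800 * ((d : ℝ) + 1) ^ 2 * ((d : ℝ) + 4)) * α₀)
      * (1 + 8 * (131072 * ((d : ℝ) + 1) ^ 2) * ((L : ℝ) ^ (k + 1) * b₁)) ≤ 2)
    (hc₃ : 2 * ((L : ℝ) ^ (k + 1) * b₁) ≤ c3 d L) (hsm : 2048 * (d : ℝ) * ((L : ℝ) ^ (k + 1) * b₁) ≤ 1) (z : Site d) :
    ‖((vcov L W (relPert W Y) (k + 1) z : (Matrix n n ℂ)ˣ) : (Matrix n n ℂ)) - 1‖ ≤ 64 * (d : ℝ) * ((L : ℝ) ^ (k + 1) * b₁) := by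
  letI : CStarAlgebra (Matrix n n ℂ) := {}
  have hG := avgClosed_unitaryUnits d (𝔸 := Matrix n n ℂ) L
  have hU₀ : ∀ (y : Site d) (κ : Fin d), W y κ ∈ unitaryUnits (Matrix n n ℂ) := hWu
  have hBsup : ∀ (y : Site d) (κ : Fin d), ‖adField W Y y κ‖ ≤ b₁ := fun y κ => by
    unfold adField; rw [norm_Ad_of_unitary (hWu y κ)]; exact hY y κ
  have h := eq163_general (j := k + 1) hL hG hU₀ hα hα3 hα4 h52 hb₁ hBsup hsmall hc₃ hsm le_rfl z
  rw [relPert_eq_expCfg_adField]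
  exact h.1.1.trans h.2

include hL hWu hα hα3 hα4 h52 in
/-- **HOLOMORPHY OF THE ACCUMULATED FRAME'S LOGARITHM ALONG A COMPLEX LINE**: if `sup‖X + t₀•D‖ < b₁` strictly, `D` is bounded and the Prop-4 regime holds at radius `b₁` (with
`2048·d·L^{k+1}b₁ ≤ 1`), then `t ↦ mlog v_{k+1}(X + t•D)(z)` is analytic at `t₀` (B7 Prop. 6's analyticity of the frames, `analyticAt_vcovQ`, composed with the analytic `log` on
`‖v − 1‖ ≤ 1∕32`; the genuine `vcov ∘ relPert` agrees with the composite on a neighbourhood of `t₀`). [cite: Balaban1985Averaging, Proposition 6 p.43, (160) p.42] -/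
theorem analyticAt_mlog_vcov_line (κ₀ : Fin d) {X D : Site d → Fin d → (Matrix n n ℂ)} {b₁ δ s₀ : ℝ} (hδ : 0 ≤ δ) (hD : ∀ y κ, ‖D y κ‖ ≤ δ)
    {t₀ : ℂ} (hs₀ : s₀ < b₁) (hX₀ : ∀ y κ, ‖X y κ + t₀ • D y κ‖ ≤ s₀)
    (hsmall : Real.exp (4 * (800 * ((d : ℝ) + 1) ^ 2 * ((d : ℝ) + 4)) * α₀)
      * (1 + 8 * (131072 * ((d : ℝ) + 1) ^ 2) * ((L : ℝ) ^ (k + 1) * b₁)) ≤ 2)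
    (hc₃ : 2 * ((L : ℝ) ^ (k + 1) * b₁) ≤ c3 d L) (hsm : 2048 * (d : ℝ) * ((L : ℝ) ^ (k + 1) * b₁) ≤ 1) (z : Site d) :
    AnalyticAt ℂ (fun t : ℂ => mlog ((vcov L W (relPert W (fun y κ => X y κ + t • D y κ)) (k + 1) z : (Matrix n n ℂ)ˣ) : (Matrix n n ℂ))) t₀ := by
  letI : CStarAlgebra (Matrix n n ℂ) := {}
  have hL1 : 1 ≤ L := by omega
  have hG := avgClosed_unitaryUnits d (𝔸 := Matrix n n ℂ) L
  have hU₀ : ∀ (y : Site d) (κ : Fin d), W y κ ∈ unitaryUnits (Matrix n n ℂ) := hWu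
  have hs₀0 : 0 ≤ s₀ := (norm_nonneg _).trans (hX₀ 0 κ₀)
  have hb₁ : 0 ≤ b₁ := hs₀0.trans hs₀.le
  -- the analytic parametrisation `B(t) = adField W (X + t•D)`
  set B : ℂ → Site d → Fin d → (Matrix n n ℂ) := fun t => adField W (fun y κ => X y κ + t • D y κ) with hB
  have hBa : ∀ (y : Site d) (κ : Fin d), AnalyticAt ℂ (fun t => B t y κ) t₀ := by
    intro y κ
    have e : (fun t => B t y κ) = fun t : ℂ => Ad (W y κ) (X y κ) + t • Ad (W y κ) (D y κ) := by
      funext t; simp only [hB, adField, Ad_add, Ad_smul]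
    rw [e]
    exact analyticAt_const.add (analyticAt_id.smul analyticAt_const)
  have hBsup : ∀ (y : Site d) (κ : Fin d), ‖B t₀ y κ‖ ≤ b₁ := fun y κ => by
    simp only [hB, adField]; rw [norm_Ad_of_unitary (hWu y κ)]; exact (hX₀ y κ).trans hs₀.le
  -- the composite frames are analytic at `t₀`
  have hv := (analyticAt_vcovQ L hL hG (k + 1) W hU₀ hα hα3 hα4 h52 B hBa hb₁ hBsup hsmall hc₃ κ₀ (k + 1) le_rfl z).1
  -- the composite IS the frame near `t₀` (sup stays `≤ b₁` for `‖t − t₀‖·δ ≤ b₁ − s₀`)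
  have hnear : ∀ᶠ t in 𝓝 t₀, ∀ y κ, ‖X y κ + t • D y κ‖ ≤ b₁ := by
    have hr : 0 < (b₁ - s₀) / (δ + 1) := div_pos (by linarith) (by linarith)
    filter_upwards [Metric.ball_mem_nhds t₀ hr] with t ht y κ
    have hdt : dist t t₀ < (b₁ - s₀) / (δ + 1) := ht
    rw [dist_eq_norm] at hdt
    have e : X y κ + t • D y κ = (X y κ + t₀ • D y κ) + (t - t₀) • D y κ := by rw [sub_smul]; abel
    rw [e]
    calc ‖X y κ + t₀ • D y κ + (t - t₀) • D y κ‖ ≤ ‖X y κ + t₀ • D y κ‖ + ‖(t - t₀) • D y κ‖ := norm_add_le _ _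
      _ ≤ s₀ + ‖t - t₀‖ * δ := by
          rw [norm_smul]; exact add_le_add (hX₀ y κ) (mul_le_mul_of_nonneg_left (hD y κ) (norm_nonneg _))
      _ ≤ b₁ := by
          have h1 : ‖t - t₀‖ * δ ≤ (b₁ - s₀) / (δ + 1) * δ := mul_le_mul_of_nonneg_right hdt.le hδ
          have h2 : (b₁ - s₀) / (δ + 1) * δ ≤ b₁ - s₀ := by
            rw [div_mul_eq_mul_div, div_le_iff₀ (by linarith)]; nlinarith
          linarith
  have heq : (fun t : ℂ => ((vcovQ L W (B t) (k + 1) z : (Matrix n n ℂ)ˣ) : (Matrix n n ℂ)))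
      =ᶠ[𝓝 t₀] fun t => ((vcov L W (relPert W (fun y κ => X y κ + t • D y κ)) (k + 1) z : (Matrix n n ℂ)ˣ) : (Matrix n n ℂ)) := by
    filter_upwards [hnear] with t ht
    rw [vcov_relPert_eq_vcovQ hL k hWu hα hα3 hα4 h52 hb₁ ht hsmall hc₃ (k + 1) le_rfl]
  have hv' : AnalyticAt ℂ (fun t : ℂ => ((vcov L W (relPert W (fun y κ => X y κ + t • D y κ)) (k + 1) z : (Matrix n n ℂ)ˣ) : (Matrix n n ℂ))) t₀ :=
    hv.congr heq
  -- `log` is analytic at `v(t₀)`, which is within `1/32` of `1`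
  have h1 : ‖((vcov L W (relPert W (fun y κ => X y κ + t₀ • D y κ)) (k + 1) z : (Matrix n n ℂ)ˣ) : (Matrix n n ℂ)) - 1‖ < 1 := by
    have h := norm_vcov_relPert_sub_one_le hL k hWu hα hα3 hα4 h52 hb₁ (fun y κ => (hX₀ y κ).trans hs₀.le) hsmall hc₃ hsm z
    have hd0 : (0 : ℝ) ≤ d := Nat.cast_nonneg d
    nlinarith
  exact AnalyticAt.comp (g := mlog) (f := fun t : ℂ => ((vcov L W (relPert W (fun y κ => X y κ + t • D y κ)) (k + 1) z : (Matrix n n ℂ)ˣ) : (Matrix n n ℂ)))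
    (x := t₀) (analyticAt_mlog h1) hv'
set_option maxHeartbeats 400000 in
include hL hWu hα hα3 hα4 h52 in
/-- **(LP) — THE NONLINEAR-MINUS-LINEAR ACCUMULATED FRAME IS LIPSCHITZ WITH A SECOND-ORDER CONSTANT**: in the multi-level small-field class at `W` (for the ℂ-linearity of `framePotW`)
and the Prop-4 regime at radius `b₁ = 2(b + δ)`, for fields `X, D` with `sup‖X‖ ≤ b`, `sup‖D‖ ≤ δ`:
`‖(mlog v_{k+1}(X + D)(z) − framePotW (X + D) z) − (mlog v_{k+1}(X)(z) − framePotW X z)‖ ≤ 8·C_Γ·(L^{k+1})²·(b + δ)·δ`, `C_Γ = 56(dL)² + 16C₁dL`, `C₁ = 131072(d+1)²`.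
Analyticity of `t ↦ P(X + t•D)(z)` on the ball `‖t‖ < b∕δ + 2` + the sup letter `norm_mlog_vcov_sub_framePotW_le` (valid for COMPLEX fields) + Schwarz. [folklore] -/
theorem norm_frameDefect_sub_le (κ₀ : Fin d) {x : ℝ} (hx : 0 ≤ x) (hs : LevelSmall d L k x) (hWx : SmallField W x)
    {X D : Site d → Fin d → (Matrix n n ℂ)} {b δ : ℝ} (hb : 0 ≤ b) (hδ : 0 ≤ δ) (hX : ∀ y κ, ‖X y κ‖ ≤ b) (hD : ∀ y κ, ‖D y κ‖ ≤ δ)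
    (hsmall : Real.exp (4 * (800 * ((d : ℝ) + 1) ^ 2 * ((d : ℝ) + 4)) * α₀)
      * (1 + 8 * (131072 * ((d : ℝ) + 1) ^ 2) * ((L : ℝ) ^ (k + 1) * (2 * (b + δ)))) ≤ 2)
    (hc₃ : 2 * ((L : ℝ) ^ (k + 1) * (2 * (b + δ))) ≤ c3 d L) (h100 : 100 * ((d : ℝ) * L * ((L : ℝ) ^ (k + 1) * (2 * (b + δ)))) ≤ 1)
    (hC16 : 16 * (131072 * ((d : ℝ) + 1) ^ 2) * ((L : ℝ) ^ (k + 1) * (2 * (b + δ))) ≤ 1)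
    (hsm : 2048 * (d : ℝ) * ((L : ℝ) ^ (k + 1) * (2 * (b + δ))) ≤ 1) (z : Site d) :
    ‖(mlog ((vcov L W (relPert W (fun y κ => X y κ + D y κ)) (k + 1) z : (Matrix n n ℂ)ˣ) : (Matrix n n ℂ)) - framePotW L (k + 1) W (fun y κ => X y κ + D y κ) z)
        - (mlog ((vcov L W (relPert W X) (k + 1) z : (Matrix n n ℂ)ˣ) : (Matrix n n ℂ)) - framePotW L (k + 1) W X z)‖
      ≤ 8 * (56 * ((d : ℝ) * L) ^ 2 + 16 * (131072 * ((d : ℝ) + 1) ^ 2) * ((d : ℝ) * L)) * ((L : ℝ) ^ (k + 1)) ^ 2 * (b + δ) * δ := by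
  letI : CStarAlgebra (Matrix n n ℂ) := {}
  have hL1 : 1 ≤ L := by omega
  set CΓ : ℝ := 56 * ((d : ℝ) * L) ^ 2 + 16 * (131072 * ((d : ℝ) + 1) ^ 2) * ((d : ℝ) * L) with hCΓ
  have hCΓ0 : 0 ≤ CΓ := by positivity
  set b₁ : ℝ := 2 * (b + δ) with hb₁
  have hb₁0 : 0 ≤ b₁ := by positivity
  -- the sup letter for every COMPLEX field of sup `≤ b₁`
  have hP : ∀ Y : Site d → Fin d → (Matrix n n ℂ), (∀ y κ, ‖Y y κ‖ ≤ b₁) →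
      ‖mlog ((vcov L W (relPert W Y) (k + 1) z : (Matrix n n ℂ)ˣ) : (Matrix n n ℂ)) - framePotW L (k + 1) W Y z‖ ≤ CΓ * ((L : ℝ) ^ (k + 1) * b₁) ^ 2 :=
    fun Y hY => NE7AccumulatedFrameLinearisation.norm_mlog_vcov_sub_framePotW_le hL (k + 1) hWu hα hα3 hα4 h52 hb₁0 hY hsmall hc₃ h100 hC16 z
  -- the degenerate case `δ = 0`: `D = 0`
  rcases hδ.eq_or_lt with hδ0 | hδpos
  · have hD0 : ∀ y κ, D y κ = 0 := fun y κ => norm_le_zero_iff.mp (hδ0 ▸ hD y κ)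
    have e : (fun y κ => X y κ + D y κ) = X := by funext y κ; rw [hD0, add_zero]
    rw [e, sub_self, norm_zero, ← hδ0]; positivity
  -- the holomorphic function on the ball `‖t‖ < R₁ := b/δ + 2`
  set R₁ : ℝ := b / δ + 2 with hR₁
  have hR₁2 : 2 ≤ R₁ := by have : 0 ≤ b / δ := div_nonneg hb hδpos.le; linarith
  have hR₁pos : 0 < R₁ := by linarith
  have hR₁δ : R₁ * δ = b + 2 * δ := by rw [hR₁]; field_simp
  set f : ℂ → (Matrix n n ℂ) := fun t => mlog ((vcov L W (relPert W (fun y κ => X y κ + t • D y κ)) (k + 1) z : (Matrix n n ℂ)ˣ) : (Matrix n n ℂ))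
    - framePotW L (k + 1) W (fun y κ => X y κ + t • D y κ) z with hf
  -- sup bound on the open ball, strict
  have hsup : ∀ t : ℂ, ‖t‖ < R₁ → ∀ y κ, ‖X y κ + t • D y κ‖ ≤ b + ‖t‖ * δ := fun t _ y κ => norm_line_le hX hD t y κ
  have hlt : ∀ t : ℂ, ‖t‖ < R₁ → b + ‖t‖ * δ < b₁ := by
    intro t ht
    have : ‖t‖ * δ < R₁ * δ := mul_lt_mul_of_pos_right ht hδpos
    rw [hR₁δ] at this; rw [hb₁]; linarith
  -- holomorphy on the ball
  have hdiff : DifferentiableOn ℂ f (ball (0 : ℂ) R₁) := by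
    intro t ht
    have ht' : ‖t‖ < R₁ := by simpa using ht
    have han : AnalyticAt ℂ f t := by
      have h1 := analyticAt_mlog_vcov_line hL k hWu hα hα3 hα4 h52 κ₀ hδ hD (hlt t ht') (hsup t ht') hsmall hc₃ hsm z
      have h2 : AnalyticAt ℂ (fun s : ℂ => framePotW L (k + 1) W X z + s • framePotW L (k + 1) W D z) t :=
        analyticAt_const.add (analyticAt_id.smul analyticAt_const)
      have e : f = fun s => mlog ((vcov L W (relPert W (fun y κ => X y κ + s • D y κ)) (k + 1) z : (Matrix n n ℂ)ˣ) : (Matrix n n ℂ))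
          - (framePotW L (k + 1) W X z + s • framePotW L (k + 1) W D z) := by
        funext s
        simp only [hf]
        rw [framePotW_line hL1 k hWu hx hs hWx X D s z]
      rw [e]; exact h1.sub h2
    exact han.differentiableAt.differentiableWithinAt
  -- the ball maps into the closed ball of radius `R₂ = 2·C_Γ(L^{k+1}b₁)²` around `f 0`
  set R₂ : ℝ := 2 * (CΓ * ((L : ℝ) ^ (k + 1) * b₁) ^ 2) with hR₂
  have eX0 : (fun y κ => X y κ + (0 : ℂ) • D y κ) = X := by funext y κ; rw [zero_smul, add_zero]
  have eX1 : (fun y κ => X y κ + (1 : ℂ) • D y κ) = fun y κ => X y κ + D y κ := by funext y κ; rw [one_smul]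
  have hf0 : ‖f 0‖ ≤ CΓ * ((L : ℝ) ^ (k + 1) * b₁) ^ 2 := by
    simp only [hf, eX0]
    exact hP X fun y κ => (hX y κ).trans (by rw [hb₁]; linarith [(norm_nonneg _).trans (hD y κ)])
  have hmaps : MapsTo f (ball (0 : ℂ) R₁) (closedBall (f 0) R₂) := by
    intro t ht
    have ht' : ‖t‖ < R₁ := by simpa using ht
    have hft : ‖f t‖ ≤ CΓ * ((L : ℝ) ^ (k + 1) * b₁) ^ 2 :=
      hP (fun y κ => X y κ + t • D y κ) fun y κ => (hsup t ht' y κ).trans (hlt t ht').le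
    rw [mem_closedBall, dist_eq_norm]
    calc ‖f t - f 0‖ ≤ ‖f t‖ + ‖f 0‖ := norm_sub_le _ _
      _ ≤ R₂ := by rw [hR₂]; linarith
  -- Schwarz at `t = 1`
  have h1mem : (1 : ℂ) ∈ ball (0 : ℂ) R₁ := by simp; linarith
  have hS := Complex.dist_le_div_mul_dist_of_mapsTo_ball hdiff hmaps h1mem
  rw [dist_eq_norm, dist_zero_right, norm_one, mul_one] at hS
  have ef1 : f 1 = mlog ((vcov L W (relPert W (fun y κ => X y κ + D y κ)) (k + 1) z : (Matrix n n ℂ)ˣ) : (Matrix n n ℂ)) - framePotW L (k + 1) W (fun y κ => X y κ + D y κ) z := by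
    simp only [hf, eX1]
  have ef0 : f 0 = mlog ((vcov L W (relPert W X) (k + 1) z : (Matrix n n ℂ)ˣ) : (Matrix n n ℂ)) - framePotW L (k + 1) W X z := by
    simp only [hf, eX0]
  rw [ef1, ef0] at hS
  refine hS.trans ?_
  -- `R₂ / R₁ = 8 C_Γ L^{2(k+1)} (b+δ)² δ / (b + 2δ) ≤ 8 C_Γ L^{2(k+1)} (b+δ) δ`
  have hM : 0 ≤ ((L : ℝ) ^ (k + 1)) ^ 2 := by positivity
  have hbd : b + 2 * δ > 0 := by linarith
  have hR₁' : R₁ = (b + 2 * δ) / δ := by rw [hR₁]; field_simp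
  rw [div_le_iff₀ hR₁pos, hR₂, hb₁, hR₁']
  rw [show 8 * CΓ * ((L : ℝ) ^ (k + 1)) ^ 2 * (b + δ) * δ * ((b + 2 * δ) / δ)
      = 8 * CΓ * ((L : ℝ) ^ (k + 1)) ^ 2 * (b + δ) * (b + 2 * δ) by field_simp]
  have key : (b + δ) * (b + δ) ≤ (b + δ) * (b + 2 * δ) := by nlinarith
  nlinarith [mul_le_mul_of_nonneg_left key (by positivity : 0 ≤ 8 * CΓ * ((L : ℝ) ^ (k + 1)) ^ 2)]

include hL hWu hα hα3 hα4 h52 in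
/-- **(LP), two-field form**: `‖P(X′)(z) − P(X)(z)‖ ≤ 8·C_Γ·(L^{k+1})²·(b + δ)·δ` for `sup‖X‖ ≤ b`, `sup‖X′ − X‖ ≤ δ` (the engine's letter: the extra corner junk of a step of
size `δ` is `8C_Γ·(M(b+δ))·(Mδ)`, a multiple `O(M·b) = O(ε)` of `M·δ`). [folklore] -/
theorem norm_frameDefect_sub_frameDefect_le (κ₀ : Fin d) {x : ℝ} (hx : 0 ≤ x) (hs : LevelSmall d L k x) (hWx : SmallField W x)
    {X X' : Site d → Fin d → (Matrix n n ℂ)} {b δ : ℝ} (hb : 0 ≤ b) (hδ : 0 ≤ δ) (hX : ∀ y κ, ‖X y κ‖ ≤ b) (hD : ∀ y κ, ‖X' y κ - X y κ‖ ≤ δ)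
    (hsmall : Real.exp (4 * (800 * ((d : ℝ) + 1) ^ 2 * ((d : ℝ) + 4)) * α₀)
      * (1 + 8 * (131072 * ((d : ℝ) + 1) ^ 2) * ((L : ℝ) ^ (k + 1) * (2 * (b + δ)))) ≤ 2)
    (hc₃ : 2 * ((L : ℝ) ^ (k + 1) * (2 * (b + δ))) ≤ c3 d L) (h100 : 100 * ((d : ℝ) * L * ((L : ℝ) ^ (k + 1) * (2 * (b + δ)))) ≤ 1)
    (hC16 : 16 * (131072 * ((d : ℝ) + 1) ^ 2) * ((L : ℝ) ^ (k + 1) * (2 * (b + δ))) ≤ 1)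
    (hsm : 2048 * (d : ℝ) * ((L : ℝ) ^ (k + 1) * (2 * (b + δ))) ≤ 1) (z : Site d) :
    ‖(mlog ((vcov L W (relPert W X') (k + 1) z : (Matrix n n ℂ)ˣ) : (Matrix n n ℂ)) - framePotW L (k + 1) W X' z)
        - (mlog ((vcov L W (relPert W X) (k + 1) z : (Matrix n n ℂ)ˣ) : (Matrix n n ℂ)) - framePotW L (k + 1) W X z)‖
      ≤ 8 * (56 * ((d : ℝ) * L) ^ 2 + 16 * (131072 * ((d : ℝ) + 1) ^ 2) * ((d : ℝ) * L)) * ((L : ℝ) ^ (k + 1)) ^ 2 * (b + δ) * δ := by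
  have e : X' = fun y κ => X y κ + (X' y κ - X y κ) := by funext y κ; abel
  have h := norm_frameDefect_sub_le hL k hWu hα hα3 hα4 h52 κ₀ hx hs hWx (D := fun y κ => X' y κ - X y κ) hb hδ hX hD hsmall hc₃ h100 hC16 hsm z
  rw [← e] at h
  exact h

end Analytic

end
end Summit.QuantumFields.BalabanUV.T4Continuum.NE7FrameDefectLipschitz
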